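import Summits.CriticalPhenomena.PercolationContinuityZ3.Theorems.PercNearOneGluingNoHeavyQuantSingleGatePointPieces
import HarnessLib

/-!
# QUANT lane R8, T-DEC, the q < 1 slice of `SingleGateConvClosed`: CONJECTURE R IN THE SINGLE-GATE SHAPE — the gated shift
# `gate_q(μ(· − k))` of a second factor is DEC at EVERY layer at its mean `q·(T + k)` from the ONE-GATE hypothesis of
# `SingleGateConvClosed` on `μ` alone (the lead g29 ingredient "R_aν DEC at every layer" of the reduction PM1 ⟸ (MT-R))

builds on p205010 (kernel theorem, internal audit signed; external expert review pending)

Support file (`--supports stmt-CriticalPhenomena-4575`), QUANT lane seat prim-quant-arm-2 (gen 33), rung R8 of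
`run/shared/lean/prim/quant/LADDER.md`; lane INBOX 2026-08-22T16:43Z (lead g29, V307: `pslice(ν,a,g) = (1−g)ν + g·R_aν`,
"PM1-window ⟸ (MT-R) + Theorem A + typer g26's `decAt_gatedShift_succ`").  Theorems only (no definitions), standard axioms, no sorries.

WHAT.  Typer g26 proved Conjecture R (`gatedShiftDEC_holds`, `…QuantGatedShiftDECHolds`) in the `SDECUpTo` shape: ALL gates `q ≤ Q` in the
hypothesis and in the conclusion.  The statement of record above `FarTreeRow` is now the ONE-gate binder `LawDec.SingleGateConvClosed` (lead g28),
whose hypothesis on a factor `μ` is: `gate μ q` top-affordable at `y` and `DECAt y j′ M (gate μ q)` for the single gate `q` and all `j′ < M`.  This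
file restates R in that shape — the induction of `gatedShift_sdecUpTo` run on the one-gate invariant, each step being typer g26's one-layer,
one-gate theorem `decAt_gatedShift_succ` (layers `≥ 1`) and criterion E (layer `0`, `y ≤ q`):

* `LawDec.gatedShift_singleGate_one` — one sure relay: the one-gate hypothesis for `μ` on `{0..M}` gives it for `μ(· − 1)` on `{0..M+1}`.
* **`LawDec.gatedShift_singleGate`** — `k` sure relays: … for `μ(· − k)` on `{0..M+k}` (all layers below the top).
* **`LawDec.decAtT_gateShift_allLayers`** — packaged at EVERY layer (Theorem A at and above the top, via arm-2 g33's
  `decAtT_gate_allLayers`): `DECAtT y (q·(T + k)) J (M + k) (gate (μ(· − k)) q)` for all `J`, `T` the mean of `μ`.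
  With `ν = gate_q μ₁` (`μ₁` empty-free) and `R_aν := ν(0)δ₀ + Σ_{h ≥ 1} ν(h)δ_{h+a} = gate_q(μ₁(· − a))` this is lead g29's ingredient
  "`R_aν` DEC at every layer at target `T + a(1−p)`" from the single-gate hypothesis on `μ₁`.
* **`LawDec.singleGateConvClosed_point`** — `SingleGateConvClosed` HOLDS when the first factor is a sure block `δ_k` (`M₁ = k`), in the
  conjecture's literal binder shape (`lconv k M₂ δ_k μ₂ = μ₂(· − k)`, typer g25's `lconv_point_left`).
The side condition `y ≤ q` is implied by top-affordability as soon as `M ≥ 1` (`y·M ≤ q·T ≤ q·M`); for `M = 0` it is genuinely needed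
(`gate_q δ_k` at a layer `< k` is DEC iff `y ≤ q`) and holds in every tree instance (the floor is at most every gate on the path).
HONEST STATUS: nothing new is claimed about `SingleGateConvClosed` itself (OPEN); RATE class log\* and the honest sentence unchanged.

[this work]; Conjecture R and the one-layer theorem: prim-quant-stmt g25/g26; single-gate binder: prim-quant-lead g28 (this lane).  Nothing here
is cited as a published result.  The gluing rows served [cite: KozmaNitzan2024, Conjecture 3 (p. 15)]; product measure [cite: Grimmett1999, §1.3 p. 10].
-/

noncomputable section

namespace Summit.CriticalPhenomena.PercolationContinuityZ3.Theorems

namespace Quant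

open Finset

namespace LawDec

/-- **ONE SURE RELAY, SINGLE GATE.**  `0 < y < 1`, `0 < q ≤ 1`, `y ≤ q`; `μ` a probability law on `{0..M}` with `y·M ≤ q·T` (`T` its mean)
and `DECAt y j M (gate μ q)` for all `j < M`.  Then `DECAt y j (M+1) (gate (μ(· − 1)) q)` for all `j < M + 1`: layer `0` by criterion E
(`y(1−q) ≤ q(1−y)`), layers `J + 1` by `decAt_gatedShift_succ` at base floor `x = y/q`. [this work] -/
theorem gatedShift_singleGate_one (y q : ℝ) (M : ℕ) (μ : ℕ → ℝ) (hy0 : 0 < y) (hy1 : y < 1) (hq0 : 0 < q) (hq1 : q ≤ 1)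
    (hyq : y ≤ q) (hμ0 : ∀ h, 0 ≤ μ h) (hμM : ∀ h, M < h → μ h = 0) (hμ1 : ∑ h ∈ Finset.range (M + 1), μ h = 1)
    (hta : y * (M : ℝ) ≤ q * ∑ h ∈ Finset.range (M + 1), (h : ℝ) * μ h)
    (hS : ∀ j, j < M → DECAt y j M (gate μ q)) :
    ∀ j, j < M + 1 → DECAt y j (M + 1) (gate (fun t => if 1 ≤ t then μ (t - 1) else 0) q) := by
  intro j hj
  set x : ℝ := y / q with hx
  have hx0 : 0 < x := div_pos hy0 hq0
  have hx1 : x ≤ 1 := by rw [hx, div_le_one hq0]; exact hyq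
  have hqx : q * x = y := by rw [hx]; field_simp
  by_cases hj0 : j = 0
  · -- layer 0: the gate-zero rides the giants
    subst hj0
    obtain ⟨L0, LM, L1, -, hL00, -⟩ := gate_shift_laws q M μ (fun t => if 1 ≤ t then μ (t - 1) else 0) hq0.le hq1 hμ0 hμM hμ1
      (fun t => rfl)
    refine decAt_of_giantsAbsorbLows y 0 (M + 1) _ hj L0 LM L1 hy0 ?_
    have hlows : ∑ h ∈ Finset.range (0 + 1),
        (if 2 * (h : ℝ) < ∑ k ∈ Finset.range (M + 1 + 1), (k : ℝ) * gate (fun t => if 1 ≤ t then μ (t - 1) else 0) q k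
          then gate (fun t => if 1 ≤ t then μ (t - 1) else 0) q h else 0) ≤ 1 - q := by
      rw [zero_add, Finset.sum_range_one]
      split_ifs
      · exact le_of_eq hL00
      · linarith
    have hgiants : ∑ h ∈ Finset.Ico (0 + 1) (M + 1 + 1), gate (fun t => if 1 ≤ t then μ (t - 1) else 0) q h = q := by
      have := Finset.sum_range_add_sum_Ico (gate (fun t => if 1 ≤ t then μ (t - 1) else 0) q)
        (show 0 + 1 ≤ M + 1 + 1 by omega)
      rw [L1, zero_add, Finset.sum_range_one, hL00] at this
      linarith
    rw [hgiants]
    have := mul_le_mul_of_nonneg_left hlows hy0.le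
    nlinarith
  · obtain ⟨J, rfl⟩ : ∃ J, j = J + 1 := ⟨j - 1, by omega⟩
    have hta' : x * (M : ℝ) ≤ ∑ h ∈ Finset.range (M + 1), (h : ℝ) * μ h := by
      have e : x * (M : ℝ) = (y * (M : ℝ)) / q := by rw [hx]; ring
      rw [e, div_le_iff₀ hq0]
      linarith
    have h := hS J (by omega)
    rw [← hqx] at h ⊢
    exact decAt_gatedShift_succ x q J M μ hx0 hx1 hq0 hq1 (by rw [hqx]; exact hy1) hμ0 hμM hμ1 hta' (by omega) h

/-- **`k` SURE RELAYS, SINGLE GATE** (induction on `k`; the shifted law is again a top-affordable probability law, `shift_laws`):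
the one-gate hypothesis for `μ` on `{0..M}` gives `DECAt y j (M + k) (gate (μ(· − k)) q)` for all `j < M + k`. [this work] -/
theorem gatedShift_singleGate (y q : ℝ) (k M : ℕ) (μ : ℕ → ℝ) (hy0 : 0 < y) (hy1 : y < 1) (hq0 : 0 < q) (hq1 : q ≤ 1)
    (hyq : y ≤ q) (hμ0 : ∀ h, 0 ≤ μ h) (hμM : ∀ h, M < h → μ h = 0) (hμ1 : ∑ h ∈ Finset.range (M + 1), μ h = 1)
    (hta : y * (M : ℝ) ≤ q * ∑ h ∈ Finset.range (M + 1), (h : ℝ) * μ h)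
    (hS : ∀ j, j < M → DECAt y j M (gate μ q)) :
    ∀ j, j < M + k → DECAt y j (M + k) (gate (fun t => if k ≤ t then μ (t - k) else 0) q) := by
  induction k with
  | zero =>
    intro j hj
    have e : (fun t => if 0 ≤ t then μ (t - 0) else 0) = μ := by
      funext t; rw [if_pos (Nat.zero_le t), Nat.sub_zero]
    rw [e]
    exact hS j (by omega)
  | succ n ih =>
    obtain ⟨s0, sM, s1, smean⟩ := shift_laws n M μ hμ0 hμM hμ1
    have eM : n + M = M + n := Nat.add_comm n M
    rw [eM] at sM s1 smean
    have hta' : y * ((M + n : ℕ) : ℝ) ≤ q * ∑ t ∈ Finset.range (M + n + 1), (t : ℝ) * (fun t => if n ≤ t then μ (t - n) else 0) t := by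
      rw [smean]; push_cast
      have : y * (n : ℝ) ≤ q * n := mul_le_mul_of_nonneg_right hyq (Nat.cast_nonneg n)
      nlinarith
    have h1 := gatedShift_singleGate_one y q (M + n) (fun t => if n ≤ t then μ (t - n) else 0) hy0 hy1 hq0 hq1 hyq s0 sM s1 hta' ih
    have e : (fun t => if 1 ≤ t then (fun t => if n ≤ t then μ (t - n) else 0) (t - 1) else 0)
        = fun t => if n + 1 ≤ t then μ (t - (n + 1)) else 0 := by
      funext t
      beta_reduce
      by_cases ht : n + 1 ≤ t
      · rw [if_pos ht, if_pos (by omega), if_pos (by omega), show t - 1 - n = t - (n + 1) by omega]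
      · rw [if_neg ht]
        by_cases h1 : 1 ≤ t
        · rw [if_pos h1, if_neg (by omega)]
        · rw [if_neg h1]
    rw [e, show M + n + 1 = M + (n + 1) by omega] at h1
    exact h1

/-- **CONJECTURE R, SINGLE GATE, EVERY LAYER.**  `0 < y < 1`, `0 < q ≤ 1`, `y ≤ q`; `μ` a probability law on `{0..M}` (mean `T`) with
`y·M ≤ q·T` and `DECAt y j′ M (gate μ q)` for all `j′ < M` (the hypothesis of `SingleGateConvClosed` on a factor).  Then for every shift `k`
and EVERY layer `J`: `DECAtT y (q·(T + k)) J (M + k) (gate (μ(· − k)) q)` — below the top by `gatedShift_singleGate`, at and above it by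
Theorem A (`decAtT_gate_allLayers` applied to the shifted law, top-affordable since `y ≤ q`). [this work] -/
theorem decAtT_gateShift_allLayers (y q : ℝ) (k M : ℕ) (μ : ℕ → ℝ) (hy0 : 0 < y) (hy1 : y < 1) (hq0 : 0 < q) (hq1 : q ≤ 1)
    (hyq : y ≤ q) (hμ0 : ∀ h, 0 ≤ μ h) (hμM : ∀ h, M < h → μ h = 0) (hμ1 : ∑ h ∈ Finset.range (M + 1), μ h = 1)
    (hta : y * (M : ℝ) ≤ q * ∑ h ∈ Finset.range (M + 1), (h : ℝ) * μ h)
    (hS : ∀ j, j < M → DECAt y j M (gate μ q)) (J : ℕ) :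
    DECAtT y (q * (∑ h ∈ Finset.range (M + 1), (h : ℝ) * μ h + k)) J (M + k) (gate (fun t => if k ≤ t then μ (t - k) else 0) q) := by
  obtain ⟨s0, sM, s1, smean⟩ := shift_laws k M μ hμ0 hμM hμ1
  have eM : k + M = M + k := Nat.add_comm k M
  rw [eM] at sM s1 smean
  have hta' : y * ((M + k : ℕ) : ℝ) ≤ q * ∑ t ∈ Finset.range (M + k + 1), (t : ℝ) * (fun t => if k ≤ t then μ (t - k) else 0) t := by
    rw [smean]; push_cast
    have : y * (k : ℝ) ≤ q * k := mul_le_mul_of_nonneg_right hyq (Nat.cast_nonneg k)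
    nlinarith
  rw [← smean]
  exact decAtT_gate_allLayers y q (M + k) _ hy0 hy1 hq0 hq1 s0 sM s1 hta'
    (gatedShift_singleGate y q k M μ hy0 hy1 hq0 hq1 hyq hμ0 hμM hμ1 hta hS) J

/-- **`SingleGateConvClosed` HOLDS FOR A SURE-BLOCK FIRST FACTOR** (`μ₁ = δ_k` on `{0..k}`), in the conjecture's literal binder shape: the
hypotheses on `μ₁` are not needed beyond `y ≤ q` (which they give when `k ≥ 1`: `y·k ≤ q·k`; for `k = 0` the convolution is `μ₂` itself). [this work] -/
theorem singleGateConvClosed_point (y q : ℝ) (k M₂ : ℕ) (μ₂ : ℕ → ℝ)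
    (hy0 : 0 < y) (hy1 : y < 1) (hq0 : 0 < q) (hq1 : q ≤ 1)
    (hta₁ : y * (k : ℝ) ≤ q * ∑ h ∈ Finset.range (k + 1), (h : ℝ) * (if h = k then (1 : ℝ) else 0))
    (hμ0 : ∀ h, 0 ≤ μ₂ h) (hμM : ∀ h, M₂ < h → μ₂ h = 0) (hμ1 : ∑ h ∈ Finset.range (M₂ + 1), μ₂ h = 1)
    (hta : y * (M₂ : ℝ) ≤ q * ∑ h ∈ Finset.range (M₂ + 1), (h : ℝ) * μ₂ h)
    (hdec : ∀ j', j' < M₂ → DECAt y j' M₂ (gate μ₂ q)) :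
    ∀ j', j' < k + M₂ → DECAt y j' (k + M₂) (gate (lconv k M₂ (fun i => if i = k then (1 : ℝ) else 0) μ₂) q) := by
  intro j' _
  have hconv : lconv k M₂ (fun i => if i = k then (1 : ℝ) else 0) μ₂ = fun t => if k ≤ t then μ₂ (t - k) else 0 :=
    funext fun t => lconv_point_left k M₂ μ₂ hμM t
  rw [hconv]
  rcases Nat.eq_zero_or_pos k with hk | hk
  · -- no relay: the convolution is `μ₂`
    subst hk
    have e : (fun t => if 0 ≤ t then μ₂ (t - 0) else 0) = μ₂ := by
      funext t; rw [if_pos (Nat.zero_le t), Nat.sub_zero]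
    rw [e, zero_add, decAt_iff_decAtT, sum_mul_gate]
    exact decAtT_gate_allLayers y q M₂ μ₂ hy0 hy1 hq0 hq1 hμ0 hμM hμ1 hta hdec j'
  · have hmean₁ : ∑ h ∈ Finset.range (k + 1), (h : ℝ) * (if h = k then (1 : ℝ) else 0) = k := by
      rw [Finset.sum_eq_single_of_mem k (Finset.mem_range.2 (by omega)) (fun h _ hk' => by rw [if_neg hk', mul_zero]),
        if_pos rfl, mul_one]
    rw [hmean₁] at hta₁
    have hyq : y ≤ q := le_of_mul_le_mul_right (by linarith) (show (0 : ℝ) < k by exact_mod_cast hk)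
    obtain ⟨s0, sM, s1, smean⟩ := shift_laws k M₂ μ₂ hμ0 hμM hμ1
    rw [decAt_iff_decAtT, sum_mul_gate, smean, show k + M₂ = M₂ + k by omega]
    exact decAtT_gateShift_allLayers y q k M₂ μ₂ hy0 hy1 hq0 hq1 hyq hμ0 hμM hμ1 hta hdec j'

end LawDec

end Quant

end Summit.CriticalPhenomena.PercolationContinuityZ3.Theorems
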